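import Summits.QuantumFields.BalabanUV.T4Continuum.Support.NE7K1LinWalkLineWalk
import Summits.QuantumFields.BalabanUV.T4Continuum.Support.NE7K1LinHomUpper

/-!
# NE7K1LinWalkLineBox — row NE7 (node U5), candidate route HOM, path H1L, cell K1-lin(s): the two-cutoff line's walk expansion ON THE
# CONCRETE FINE BOX `Π_μ[0, nL(2K_μ+1)M)` — the aligned-box hypothesis of `NE7K1LinWalkLineWalk` DISCHARGED, so that the headline reads with
# no hypothesis beyond `n ≥ 1`, `M ≥ 3`, `a > 0`, `s ∈ [0,1]` and the smallness `3^{d+1}·τ♮(d,L,M,a) < 1`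

Lineage `b2b-balaban-t4-ne7-p2` (CRUX PROVER NE7 #2), generation 69; series (RW) file 15 (a corollary file), over `NE7K1LinWalkLineWalk`
(file 14: `hasSum_extLine_walk`, `twoCutoffLine_inv_entry_decay` under `hbox : R′.image (blk L) = Π[0,(2K_μ+1)Mn)`) and
`NE7K1LinHomUpper.image_blk_fineBox` (g66: the coarse labels of a fine box).

* `image_blk_lineBox` — `(Π_μ[0, nL(2K_μ+1)M)).image (blk L) = Π_μ[0,(2K_μ+1)Mn)`; `isBlockUnion_lineBox` — the fine box is a union of
  `nL`-blocks (`B4Lower18.boxDom_isBlockUnion`).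
* **`hasSum_lineBox_walk`**, **`twoCutoffLine_inv_entry_decay_box`** — file 14's two theorems on the fine box: for `n ≥ 1`, `M ≥ 3`,
  `a > 0`, EVERY `s ∈ [0,1]` and `3^{d+1}τ♮ < 1`, the random-walk expansion of `(𝒫♮(s))⁻¹` converges and
  `|(twoCutoffLine s)⁻¹(x,y)| ≤ 3^{d+1}σ′⁻¹τ♮·3^{d+1}(3^{d+1}τ♮)^{N−1}∕(1 − 3^{d+1}τ♮)` for coarse sites with `|x_μ − y_μ| ≥ (2N+3)Mn + n` in
  some coordinate — constants `lineSigma ∕ lineTau` FREE OF `s` AND OF THE MESH `1∕n`.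

HONEST FRAMING: [folklore] instantiation; Gaussian `A = 0` level, U = 1, one scale, boxes, crude explicit constants (minimal `M` with
`3^{d+1}τ♮ < 1` at `a = 1`, `L = 2`: 2674 ∕ 58315 ∕ 746591 ∕ 7738707 for `d+1 = 1…4` — static arithmetic, not optimised; the
coercivity floor `L^{−(d+1)}` enters `τ♮` squared); nothing of Bałaban's asserted; no `sorry`.  Census only; NO letter ∕ tag ∕ size of NE7
moves; NE7 NOT PRINTED ∕ NOT PROVED; spine 0∕9; FIXED FINITE T⁴, rung (B)+1; NOT infinite volume, NOT mass gap, NOT Clay.  HONEST DEPENDENCY: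
continuum YM on T⁴ ⇐ BetaPertH ∧ nine spine estimates (0/9 proved); BetaPertH ⇐ (D1) ∧ (D4) ∧ CAP+tail; G-an2-4 gates asym, D1 and NE2/3/4.
-/

noncomputable section

open Finset Matrix
open scoped Matrix.Norms.L2Operator

namespace Summit.QuantumFields.BalabanUV.T4Continuum.NE7K1LinWalkLineBox

open Literature.MathematicalPhysics.QuantumFieldTheory.Balaban1983to89
open Literature.MathematicalPhysics.QuantumFieldTheory.Balaban1983to89.B4Reflection242
open Literature.MathematicalPhysics.QuantumFieldTheory.Balaban1983to89.B4BoxCov237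
open Literature.MathematicalPhysics.QuantumFieldTheory.Balaban1983to89.B4Lower18
open NE7K1LinBlockCoords NE7K1LinSchurLineU1 NE7K1LinWalkParametrix NE7K1LinWalkCubes NE7K1LinWalkBox NE7K1LinWalkFineOp NE7K1LinWalkLine
  NE7K1LinWalkLineWalk NE7K1LinHomUpper

variable {d : ℕ} {n L M : ℕ} [NeZero L] (K : Fin (d + 1) → ℕ)

/-- **THE COARSE LABELS OF THE FINE BOX**: `(Π_μ[0, nL(2K_μ+1)M)).image (blk L) = Π_μ[0,(2K_μ+1)Mn)`. [folklore] -/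
theorem image_blk_lineBox (n M : ℕ) :
    (boxDom fun μ => n * L * ((2 * K μ + 1) * M)).image (blk L) = boxDom fun μ => (2 * K μ + 1) * (M * n) := by
  rw [image_blk_fineBox]
  congr 1
  funext μ
  ring

/-- the fine box is a union of `nL`-blocks. [folklore] -/
theorem isBlockUnion_lineBox (hn : 1 ≤ n) (M : ℕ) : IsBlockUnion (n * L) (boxDom fun μ => n * L * ((2 * K μ + 1) * M)) :=
  boxDom_isBlockUnion (Nat.one_le_iff_ne_zero.2 (Nat.mul_ne_zero (Nat.one_le_iff_ne_zero.1 hn) (NeZero.ne L))) _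

variable (hn : 1 ≤ n) (hM : 3 ≤ M) {a : ℝ} (ha : 0 < a) {s : ℝ} (hs0 : 0 ≤ s) (hs1 : s ≤ 1)

include hM ha hs0 hs1 in
/-- **THE RANDOM-WALK EXPANSION OF `(𝒫♮(s))⁻¹` ON THE FINE BOX CONVERGES**, for every `s ∈ [0,1]`, once `3^{d+1}τ♮ < 1`. [folklore] -/
theorem hasSum_lineBox_walk (hsmall : (3 : ℝ) ^ (d + 1) * lineTau d L M a < 1) :
    HasSum (fun k : ℕ =>
      (∑ J : Lab K, aPiece (extLine (isBlockUnion_fine (isBlockUnion_lineBox K hn M)) n a s)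
        (fun c : Idx L (boxDom fun μ => n * L * ((2 * K μ + 1) * M)) => cut (M * n) J.1 (site c).1)
        (fun c => if c ∈ univ.filter (fun c : Idx L (boxDom fun μ => n * L * ((2 * K μ + 1) * M)) =>
          site c ∈ region ((boxDom fun μ => n * L * ((2 * K μ + 1) * M)).image (blk L)) (M * n) n J.1) then (1 : ℝ) else 0)
        (univ.filter fun c : Idx L (boxDom fun μ => n * L * ((2 * K μ + 1) * M)) =>
          site c ∈ region ((boxDom fun μ => n * L * ((2 * K μ + 1) * M)).image (blk L)) (M * n) n J.1)) *
      (∑ J : Lab K, bPiece (extLine (isBlockUnion_fine (isBlockUnion_lineBox K hn M)) n a s)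
        (fun c : Idx L (boxDom fun μ => n * L * ((2 * K μ + 1) * M)) => cut (M * n) J.1 (site c).1)
        (fun c => if c ∈ univ.filter (fun c : Idx L (boxDom fun μ => n * L * ((2 * K μ + 1) * M)) =>
          site c ∈ region ((boxDom fun μ => n * L * ((2 * K μ + 1) * M)).image (blk L)) (M * n) n J.1) then (1 : ℝ) else 0)
        (univ.filter fun c : Idx L (boxDom fun μ => n * L * ((2 * K μ + 1) * M)) =>
          site c ∈ region ((boxDom fun μ => n * L * ((2 * K μ + 1) * M)).image (blk L)) (M * n) n J.1)) ^ k)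
      (extLine (isBlockUnion_fine (isBlockUnion_lineBox K hn M)) n a s)⁻¹ :=
  hasSum_extLine_walk K hn hM (isBlockUnion_lineBox K hn M) (image_blk_lineBox K n M) ha hs0 hs1 hsmall

include hM ha hs0 hs1 in
/-- **THE K1-lin(s) TWO-CUTOFF LINE'S PROPAGATOR ON THE BOX DECAYS GEOMETRICALLY ACROSS `M`-CUBES, UNIFORMLY IN `s ∈ [0,1]` AND IN THE
MESH**: for `n ≥ 1`, `M ≥ 3`, `a > 0`, `3^{d+1}τ♮(d,L,M,a) < 1`, every `s ∈ [0,1]` and coarse sites `x, y` of `Π_μ[0,(2K_μ+1)Mn)` with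
`|x_μ − y_μ| ≥ (2N+3)Mn + n` in some coordinate (`N ≥ 1`):
`|(twoCutoffLine s)⁻¹(x,y)| ≤ 3^{d+1}·(min(σ♮,1))⁻¹·τ♮·3^{d+1}·(3^{d+1}τ♮)^{N−1}∕(1 − 3^{d+1}τ♮)`.
[cite: Balaban1983RegularityDecay, (2.22) p.579, Corollary 2.3 (2.30) pp.580–581, case A = 0, shape] [folklore] -/
theorem twoCutoffLine_inv_entry_decay_box (hsmall : (3 : ℝ) ^ (d + 1) * lineTau d L M a < 1)
    (x y : ↥((boxDom fun μ => n * L * ((2 * K μ + 1) * M)).image (blk L))) {N : ℕ} (hN : 1 ≤ N)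
    (hfar : ∃ μ, (((2 * N + 3) * (M * n) + n : ℕ) : ℤ) ≤ |x.1 μ - y.1 μ|) :
    |(twoCutoffLine (isBlockUnion_fine (isBlockUnion_lineBox K hn M)) n a s)⁻¹ x y| ≤
      (3 : ℝ) ^ (d + 1) * (1 / min (lineSigma d L a) 1) * lineTau d L M a * (3 : ℝ) ^ (d + 1) *
        ((3 : ℝ) ^ (d + 1) * lineTau d L M a) ^ (N - 1) / (1 - (3 : ℝ) ^ (d + 1) * lineTau d L M a) :=
  twoCutoffLine_inv_entry_decay K hn hM (isBlockUnion_lineBox K hn M) (image_blk_lineBox K n M) ha hs0 hs1 hsmall x y hN hfar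

end Summit.QuantumFields.BalabanUV.T4Continuum.NE7K1LinWalkLineBox

end
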